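import Mathlib
import Literature.Geometry.Lorentzian.ReggeWheelerTortoise
import Literature.Geometry.Lorentzian.ReggeWheelerChannels
import HarnessLib

/-!
# The horizon-regular mass of the Regge–Wheeler (Maxwell) potential: `r − 2M ≍ e^{(x−xc)/2M}` and
# `V_{1,ℓ}(r(x)) = ℓ(ℓ+1) w₀ e^{(x−xc)/2M} (1 + O(e^{(x−xc)/2M}))`

Literature support file (everything proved), continuing `ReggeWheelerTortoise.lean` (which
deliberately left out the horizon asymptotics `r − 2M ≍ e^{x/2M}`) and `ReggeWheelerChannels.lean`.
For a tortoise radius function `r` with the photon sphere at `xc` (`IsTortoiseRadius M r xc`) put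
`s(x) = e^{(x−xc)/2M}` (`= κ²(X² − T²)` in Kruskal–Rindler coordinates, `κ = 1/4M`).  The tortoise
identity `r + 2M log(r − 2M) − 3M − 2M log M = x − xc` (`IsTortoiseRadius.tortoiseCoord_eq`) gives
the EXACT relation

  `r(x) − 2M = M e^{1/2} · e^{−(r(x)−2M)/2M} · s(x)`            (`sub_two_mul_eq`),

hence `0 < r − 2M ≤ M e^{1/2} s` (`sub_two_mul_le`).  For the spin-1 (Maxwell, purely centrifugal)
potential `V_{1,ℓ}(r) = (1 − 2M/r) ℓ(ℓ+1)/r² = ℓ(ℓ+1)(r − 2M)/r³` this yields the horizon expansion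
with an `ℓ`-UNIFORM relative error:

  `|V_{1,ℓ}(r(x)) − ℓ(ℓ+1) w₀ s(x)| ≤ 2 e^{1/2} w₀ ℓ(ℓ+1) s(x)²`,  `w₀ = e^{1/2}/(8M²)`,

for all `x` with `r(x) ≤ 8M/3`, i.e. on a horizon-side half-line `x ≤ x₀(M, xc)`
(`abs_linePotential_one_sub_le`, `exists_abs_linePotential_one_sub_le`).  In the Rindler frame this
says that the horizon-side Regge–Wheeler equation is the flat Klein–Gordon equation with the
horizon-regular mass `m² = ℓ(ℓ+1) w₀` up to `O(s)` — the dictionary behind the rest-packet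
refutation of the uniform photon-sphere channel inequality (route `PhotonSphereChannels` of the
Final State Conjecture).  Elementary proof: `e^{−a} ≥ 1 − a` and `(1 + y)^{−3} ≥ 1 − 3y`.

## References

* M. Dafermos, I. Rodnianski, *Lectures on black holes and linear waves*, arXiv:0811.0354,
  App. F.2 (key `DafermosRodnianski2008`).
-/

noncomputable section

open _root_.Filter _root_.Set
open scoped _root_.Topology

namespace Literature.Geometry.Lorentzian

namespace ReggeWheeler

namespace IsTortoiseRadius

variable {M : ℝ} {r : ℝ → ℝ} {xc : ℝ}

/-- **The exact horizon relation** `r(x) − 2M = M e^{1/2} e^{−(r(x)−2M)/2M} e^{(x−xc)/2M}`, from the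
tortoise identity `r + 2M log(r − 2M) − 3M − 2M log M = x − xc`.
[cite: DafermosRodnianski2008, App. F.2] -/
theorem sub_two_mul_eq (h : IsTortoiseRadius M r xc) (x : ℝ) :
    r x - 2 * M = M * Real.exp (1 / 2) * Real.exp (-(r x - 2 * M) / (2 * M))
      * Real.exp ((x - xc) / (2 * M)) := by
  have hM := h.mass_pos
  have hu := h.sub_pos x
  have hid := h.tortoiseCoord_eq x
  unfold tortoiseCoord at hid
  -- `(x - xc)/(2M) = r/(2M) + log(r − 2M) − 3/2 − log M`
  have hdiv : (x - xc) / (2 * M)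
      = r x / (2 * M) + Real.log (r x - 2 * M) - 3 / 2 - Real.log M := by
    rw [← hid]
    field_simp
  have harg : -(r x - 2 * M) / (2 * M) + (x - xc) / (2 * M)
      = Real.log (r x - 2 * M) - Real.log M - 1 / 2 := by
    rw [hdiv]
    field_simp
    ring
  have hM0 : M ≠ 0 := hM.ne'
  calc r x - 2 * M
      = M * Real.exp (1 / 2) * Real.exp (Real.log (r x - 2 * M) - Real.log M - 1 / 2) := by
        rw [Real.exp_sub, Real.exp_sub, Real.exp_log hu, Real.exp_log hM]
        field_simp
    _ = M * Real.exp (1 / 2) * Real.exp (-(r x - 2 * M) / (2 * M))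
        * Real.exp ((x - xc) / (2 * M)) := by
        rw [← harg, Real.exp_add]; ring

/-- Hence `r(x) − 2M ≤ M e^{1/2} e^{(x−xc)/2M}`: the area radius approaches the horizon radius
exponentially fast in the tortoise coordinate. [cite: DafermosRodnianski2008, App. F.2] -/
theorem sub_two_mul_le (h : IsTortoiseRadius M r xc) (x : ℝ) :
    r x - 2 * M ≤ M * Real.exp (1 / 2) * Real.exp ((x - xc) / (2 * M)) := by
  have hM := h.mass_pos
  have hu := h.sub_pos x
  have heq := h.sub_two_mul_eq x
  have hle : Real.exp (-(r x - 2 * M) / (2 * M)) ≤ 1 := by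
    rw [Real.exp_le_one_iff, neg_div]
    exact neg_nonpos.2 (div_nonneg hu.le (by positivity))
  calc r x - 2 * M = M * Real.exp (1 / 2) * Real.exp (-(r x - 2 * M) / (2 * M))
        * Real.exp ((x - xc) / (2 * M)) := heq
    _ ≤ M * Real.exp (1 / 2) * 1 * Real.exp ((x - xc) / (2 * M)) := by
        gcongr
    _ = M * Real.exp (1 / 2) * Real.exp ((x - xc) / (2 * M)) := by ring

/-- There is a horizon-side half-line `x ≤ x₀` on which `r(x) − 2M ≤ 2M/3`. [folklore] -/
theorem exists_sub_two_mul_le_third (h : IsTortoiseRadius M r xc) :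
    ∃ x₀ : ℝ, ∀ x ≤ x₀, r x - 2 * M ≤ 2 * M / 3 := by
  have hM := h.mass_pos
  have hlim := h.tendsto_atBot
  have hev : ∀ᶠ x in atBot, r x < 2 * M + 2 * M / 3 :=
    (tendsto_order.1 hlim).2 _ (by linarith)
  obtain ⟨x₀, hx₀⟩ := eventually_atBot.1 hev
  exact ⟨x₀, fun x hx => by linarith [hx₀ x hx]⟩

end IsTortoiseRadius

/-! ### The spin-1 potential near the horizon -/

/-- The Maxwell potential on the tortoise line is `ℓ(ℓ+1)(r − 2M)/r³`. [folklore] -/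
theorem linePotential_one_eq {M : ℝ} {r : ℝ → ℝ} {xc : ℝ} (h : IsTortoiseRadius M r xc) (ℓ : ℕ)
    (x : ℝ) : linePotential M 1 ℓ r x = (ℓ : ℝ) * ((ℓ : ℝ) + 1) * (r x - 2 * M) / r x ^ 3 := by
  have hr := h.pos x
  rw [linePotential_apply, rwPotential_one]
  field_simp

/-- The elementary inequality `e^{−a}(1 + y)^{−3} ≥ 1 − a − 3y` for `0 ≤ a ≤ 1`, `0 ≤ y ≤ 1/3`,
written multiplicatively. [folklore] -/
theorem one_sub_sub_le_exp_neg_div_cube {a y : ℝ} (ha : 0 ≤ a) (ha1 : a ≤ 1) (hy : 0 ≤ y)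
    (hy1 : y ≤ 1 / 3) : (1 - a - 3 * y) * (1 + y) ^ 3 ≤ Real.exp (-a) := by
  have h1 : 1 - a ≤ Real.exp (-a) := by linarith [Real.add_one_le_exp (-a)]
  have h2 : (1 - 3 * y) * (1 + y) ^ 3 ≤ 1 := by nlinarith [sq_nonneg y, mul_nonneg hy (sq_nonneg y)]
  have h3 : 0 ≤ 1 - 3 * y := by linarith
  have h4 : 0 ≤ 1 - a := by linarith
  have h5 : (1 - a - 3 * y) * (1 + y) ^ 3 ≤ (1 - a) * ((1 - 3 * y) * (1 + y) ^ 3) := by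
    nlinarith [mul_nonneg ha hy, pow_pos (show (0 : ℝ) < 1 + y by linarith) 3]
  calc (1 - a - 3 * y) * (1 + y) ^ 3 ≤ (1 - a) * ((1 - 3 * y) * (1 + y) ^ 3) := h5
    _ ≤ (1 - a) * 1 := mul_le_mul_of_nonneg_left h2 h4
    _ = 1 - a := mul_one _
    _ ≤ Real.exp (-a) := h1

/-- **Horizon expansion of the Maxwell potential, `ℓ`-uniform.** Where `r(x) − 2M ≤ 2M/3`:
`|V_{1,ℓ}(r(x)) − ℓ(ℓ+1) w₀ e^{(x−xc)/2M}| ≤ 2e^{1/2} w₀ ℓ(ℓ+1) e^{(x−xc)/M}`, `w₀ = e^{1/2}/(8M²)`.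
[cite: DafermosRodnianski2008, App. F.2] -/
theorem abs_linePotential_one_sub_le {M : ℝ} {r : ℝ → ℝ} {xc : ℝ} (h : IsTortoiseRadius M r xc)
    (ℓ : ℕ) {x : ℝ} (hx : r x - 2 * M ≤ 2 * M / 3) :
    |linePotential M 1 ℓ r x
        - (ℓ : ℝ) * ((ℓ : ℝ) + 1) * (Real.exp (1 / 2) / (8 * M ^ 2)) * Real.exp ((x - xc) / (2 * M))|
      ≤ 2 * Real.exp (1 / 2) * (Real.exp (1 / 2) / (8 * M ^ 2)) * ((ℓ : ℝ) * ((ℓ : ℝ) + 1))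
          * Real.exp ((x - xc) / M) := by
  have hM := h.mass_pos
  have hu := h.sub_pos x
  have hr := h.pos x
  set u : ℝ := r x - 2 * M with hu_def
  set s : ℝ := Real.exp ((x - xc) / (2 * M)) with hs_def
  set L : ℝ := (ℓ : ℝ) * ((ℓ : ℝ) + 1) with hL_def
  have hL : 0 ≤ L := by positivity
  have hs : 0 < s := Real.exp_pos _
  have hss : Real.exp ((x - xc) / M) = s ^ 2 := by
    rw [hs_def, ← Real.exp_nat_mul]; congr 1; push_cast; field_simp
  -- the exact relation and the size of `u`
  have hrel : u = M * Real.exp (1 / 2) * Real.exp (-u / (2 * M)) * s := h.sub_two_mul_eq x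
  have hule : u ≤ M * Real.exp (1 / 2) * s := h.sub_two_mul_le x
  have hrx : r x = 2 * M + u := by simp only [hu_def]; ring
  -- `V = L s · f(u)` with `f(u) = w₀ e^{−u/2M} (2M)³/(2M+u)³`
  have hV : linePotential M 1 ℓ r x = L * u / (2 * M + u) ^ 3 := by
    rw [linePotential_one_eq h ℓ x, hrx, hL_def]
    ring
  -- lower and upper bounds for `e^{−u/2M} (2M)^3/(2M+u)^3`
  set a : ℝ := u / (2 * M) with ha_def
  set y : ℝ := u / (2 * M) with hy_def
  have ha0 : 0 ≤ a := by positivity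
  have ha1 : a ≤ 1 := by
    rw [ha_def, div_le_one (by positivity)]; linarith
  have hy1 : y ≤ 1 / 3 := by
    rw [hy_def, div_le_iff₀ (by positivity)]; linarith
  have hden : (2 * M + u) ^ 3 = (2 * M) ^ 3 * (1 + y) ^ 3 := by
    rw [hy_def, ← mul_pow]; congr 1; field_simp
  have hlow := one_sub_sub_le_exp_neg_div_cube ha0 ha1 ha0 hy1
  -- the main estimate: `|u/(2M+u)^3 · (something) − w₀ s| ≤ 2 w₀ u s / M`
  -- write everything through `q := e^{-a} / (1+y)^3 ∈ [1 − a − 3y, 1]`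
  have hq1 : Real.exp (-a) / (1 + y) ^ 3 ≤ 1 := by
    rw [div_le_one (by positivity)]
    calc Real.exp (-a) ≤ 1 := Real.exp_le_one_iff.2 (by linarith)
      _ ≤ (1 + y) ^ 3 := one_le_pow₀ (by linarith)
  have hq0 : 1 - a - 3 * y ≤ Real.exp (-a) / (1 + y) ^ 3 := by
    rw [le_div_iff₀ (by positivity)]
    exact hlow
  -- `L u/(2M+u)^3 = L s · w₀ · q` using the exact relation `u = M e^{1/2} e^{-a} s`
  have hua : -u / (2 * M) = -a := by rw [ha_def, neg_div]
  have hVq : L * u / (2 * M + u) ^ 3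
      = L * (Real.exp (1 / 2) / (8 * M ^ 2)) * s * (Real.exp (-a) / (1 + y) ^ 3) := by
    rw [hden]
    have hM0 : M ≠ 0 := hM.ne'
    have hy0 : (1 + y) ^ 3 ≠ 0 := by positivity
    rw [hrel, hua]
    field_simp
    ring
  rw [hV, hVq, hss]
  -- now an inequality between explicit products
  have hw0 : 0 ≤ L * (Real.exp (1 / 2) / (8 * M ^ 2)) * s := by positivity
  have key : |L * (Real.exp (1 / 2) / (8 * M ^ 2)) * s * (Real.exp (-a) / (1 + y) ^ 3)
      - L * (Real.exp (1 / 2) / (8 * M ^ 2)) * s|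
      ≤ L * (Real.exp (1 / 2) / (8 * M ^ 2)) * s * (a + 3 * y) := by
    rw [show L * (Real.exp (1 / 2) / (8 * M ^ 2)) * s * (Real.exp (-a) / (1 + y) ^ 3)
        - L * (Real.exp (1 / 2) / (8 * M ^ 2)) * s
        = L * (Real.exp (1 / 2) / (8 * M ^ 2)) * s * (Real.exp (-a) / (1 + y) ^ 3 - 1) by ring,
      abs_mul, abs_of_nonneg hw0]
    refine mul_le_mul_of_nonneg_left ?_ hw0
    rw [abs_le]
    constructor <;> linarith
  refine key.trans ?_
  -- `a + 3y = 4y = 2u/M ≤ 2 e^{1/2} s`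
  have hay : a + 3 * y = 2 * u / M := by
    rw [ha_def, hy_def]; field_simp; ring
  rw [hay]
  have h2u : 2 * u / M ≤ 2 * Real.exp (1 / 2) * s := by
    rw [div_le_iff₀ hM]
    nlinarith [hule]
  calc L * (Real.exp (1 / 2) / (8 * M ^ 2)) * s * (2 * u / M)
      ≤ L * (Real.exp (1 / 2) / (8 * M ^ 2)) * s * (2 * Real.exp (1 / 2) * s) :=
        mul_le_mul_of_nonneg_left h2u hw0
    _ = 2 * Real.exp (1 / 2) * (Real.exp (1 / 2) / (8 * M ^ 2)) * L * s ^ 2 := by ring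

/-- **Horizon expansion of the Maxwell potential on a horizon-side half-line**: for some `x₀`
(depending on `M, xc` only) and every `ℓ` and `x ≤ x₀`,
`|V_{1,ℓ}(r(x)) − ℓ(ℓ+1) w₀ e^{(x−xc)/2M}| ≤ 2e^{1/2} w₀ ℓ(ℓ+1) e^{(x−xc)/M}`.
[cite: DafermosRodnianski2008, App. F.2] -/
theorem exists_abs_linePotential_one_sub_le {M : ℝ} {r : ℝ → ℝ} {xc : ℝ}
    (h : IsTortoiseRadius M r xc) :
    ∃ x₀ : ℝ, ∀ ℓ : ℕ, ∀ x ≤ x₀,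
      |linePotential M 1 ℓ r x
          - (ℓ : ℝ) * ((ℓ : ℝ) + 1) * (Real.exp (1 / 2) / (8 * M ^ 2)) * Real.exp ((x - xc) / (2 * M))|
        ≤ 2 * Real.exp (1 / 2) * (Real.exp (1 / 2) / (8 * M ^ 2)) * ((ℓ : ℝ) * ((ℓ : ℝ) + 1))
            * Real.exp ((x - xc) / M) := by
  obtain ⟨x₀, hx₀⟩ := h.exists_sub_two_mul_le_third
  exact ⟨x₀, fun ℓ x hx => abs_linePotential_one_sub_le h ℓ (hx₀ x hx)⟩

end ReggeWheeler

end Literature.Geometry.Lorentzian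

end
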